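import Summits.QuantumAdvantage.AdviceFreeQNC0.WalkExactLaw
import Summits.QuantumAdvantage.AdviceFreeQNC0.WalkCoreHub
import Summits.QuantumAdvantage.AdviceFreeQNC0.CrossTeamEmbedding
import HarnessLib

/-!
# Cell qa-qnc0 (rung F-Q1, route RingFrame, crux α `RingToElim`): the FAIL FLOOR of the walk game
# — every degree-`D` strategy on `ℓ ≥ 2D+3` bits fails on at least `2^{ℓ−2D−3}` inputs (all `D`,
# all `ℓ`, every charge); rung 0 of the density axis

Planner qa-qnc0-p1's `FullFailFloor` (TARGET §15.4(a)) — until now a prose corollary of the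
(uncertified for `ℓ > 12`) exact law — as a kernel theorem for ALL `D` and `ℓ`, from the full
exact law `fullSpan_not_perfect` (`WalkExactLaw.lean`):

* `Lfun_tr_eq_zero_of_far` — frequency vanishing (TARGET §15.5, `⊆`): the win pattern `tr f` of
  a full strategy has `L_a(tr f) = 0` at every pattern `a` far (with its conjugate) from the path;
* `iotaF_ringWinU` — the game IS a trace: `[WIN_y(u)] = tr (Σ_g [y_g(u)]·ω^{c+g+|u|+|u_{<g}|})` in `𝔽₄`;
* `fibre_mem_fullSpan` — on each fibre `w ↦ w ++ b` of the first `2D+3` coordinates the walk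
  strategy is an element of the full module `M_D(P)` on `2D+3` bits (cuts beyond the block all
  ride the last path character `ω^{2|w|}`; the degree-`D` selectors become `𝔽₄[w]_{≤D}` coefficients
  via `iotaF_mem_polySpan`, the `𝔽₂ → 𝔽₄` transfer of `HasDeg`);
* `exists_fail_on_fibre` — hence every fibre carries a failure;
* **`ringWinU_fail_floor`** — `#{u : ¬WIN} ≥ 2^{ℓ−(2D+3)}` for every walk strategy of degree `≤ D`
  on `ℓ ≥ 2D+3` bits and every charge; `card_ringWinU_le_floor` — `#WIN ≤ (1 − 2^{−(2D+3)})·2^ℓ`;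
* **`mixedHardAt_floor`** — `MixedHardAt ℓ D (1 − 2^{−(2D+5)})` for `ℓ ≥ 2D+5` (an even triple is
  a walk strategy of degree `D+1`, `evenTriple_isWalkRow`).

Reading (planner qa-qnc0-p1 ROUND-11 §1): on the DENSITY AXIS `φ(ℓ, D) ≥ 2^{−a·D}` this is the
trivial floor, exponent `a = 2`, now in the kernel for all `(ℓ, D)`; the typed target T10
(`Sketch12.RingFailLinear`) asks for `MixedHardAt (λD) D (1 − e^{−cD})` with `e^c < 2`, i.e.
exponent `< 1`.  The cell's theorem (planner qa-qnc0-p1 gen 3 statement; prover qn-prover-3 gen 5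
kernel proof), 2026-08-27; not in print.  WHAT THIS IS NOT: no constant-loss bound (that is
THEOREM V / α); exponent `2`, not `< 1`; no separation claim.
-/

noncomputable section

namespace Summit.QuantumAdvantage.AdviceFreeQNC0

open Finset
open Literature.Computability.MetaComplexity Literature.Computability.MetaComplexity.Smolensky
open F4

/-! ### Frequency vanishing (TARGET §15.5, the `⊆` direction) -/

/-- **The win pattern of a full strategy has no far frequencies**: for `f ∈ M_D(P)` and a pattern
`a` such that neither `a` nor its conjugate is within Hamming distance `D` of a path pattern,
`L_a(tr f) = 0`. [folklore] -/
theorem Lfun_tr_eq_zero_of_far {m D : ℕ} {f : (Fin m → Bool) → F4} (hf : f ∈ fullSpan m D)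
    {a : Fin m → Bool} (ha : ¬ NearPath D a) (ha' : ¬ NearPath D (conj a)) :
    Lfun a (fun u => tr (f u)) = 0 := by
  have h1 : f ∈ chiSpan (NearPath (m := m) D) := fullSpan_le_chiSpan _ _ hf
  have h2 : (fun u => f u ^ 2) ∈ chiSpan fun b => NearPath (m := m) D (conj b) := sq_mem_chiSpan h1
  have htr : (fun u => tr (f u)) ∈ chiSpan fun b => NearPath (m := m) D b ∨ NearPath D (conj b) := by
    have e : (fun u => tr (f u)) = f + fun u => f u ^ 2 := by funext u; rfl
    rw [e]
    exact Submodule.add_mem _ (chiSpan_mono (fun b hb => Or.inl hb) h1)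
      (chiSpan_mono (fun b hb => Or.inr hb) h2)
  exact Lfun_eq_zero_of_mem (P := fun b => NearPath D b ∨ NearPath D (conj b))
    (by rintro (h | h) <;> [exact ha h; exact ha' h]) htr

/-! ### The game is a trace -/

/-- `tr (ι b · x) = ι b · tr x` for a Boolean `b`. -/
private theorem tr_iotaF_mul (b : Bool) (x : F4) : tr (ιF b * x) = ιF b * tr x := by
  unfold ιF; cases b
  · simp [tr_zero]
  · simp

/-- **The walk game is a trace**: `[WIN_y(u)] = tr (Σ_g [y_g(u)]·ω^{c + g + |u| + |u_{<g}|})`. -/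
theorem iotaF_ringWinU {n : ℕ} (c : ℕ) (y : Fin (n + 1) → (Fin n → Bool) → Bool) (u : Fin n → Bool) :
    ιF (ringWinU c y u) = tr (∑ g : Fin (n + 1), ιF (y g u) * ω ^ (c + g.val + walkExp u g.val)) := by
  classical
  rw [tr_sum]
  have e : ∀ g : Fin (n + 1), tr (ιF (y g u) * ω ^ (c + g.val + walkExp u g.val)) =
      if (y g u = true ∧ (c + g.val + walkExp u g.val) % 3 ≠ 0) then 1 else 0 := by
    intro g
    rw [tr_iotaF_mul, tr_omega_pow]
    unfold ιF
    by_cases h1 : y g u = true <;> by_cases h2 : (c + g.val + walkExp u g.val) % 3 = 0 <;> simp [h1, h2]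
  rw [Finset.sum_congr rfl fun g _ => e g, ← Finset.natCast_card_filter, natCast_eq]
  unfold ringWinU ιF
  by_cases h : (univ.filter fun g : Fin (n + 1) =>
      y g u = true ∧ (c + g.val + walkExp u g.val) % 3 ≠ 0).card % 2 = 1
  · rw [if_pos h, decide_eq_true h, if_pos rfl]
  · rw [if_neg h]
    have hd : decide ((univ.filter fun g : Fin (n + 1) =>
        y g u = true ∧ (c + g.val + walkExp u g.val) % 3 ≠ 0).card % 2 = 1) = false :=
      decide_eq_false h
    rw [hd]
    simp

/-! ### Low-degree Boolean selectors are `𝔽₄`-polynomials of the same degree -/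

variable {m : ℕ}

/-- The span of the `𝔽₄`-monomials of degree `≤ D`. -/
def polySpan (m D : ℕ) : Submodule F4 ((Fin m → Bool) → F4) :=
  Submodule.span F4 {h | ∃ T : Finset (Fin m), T.card ≤ D ∧ h = monoF T}

/-- **Transfer `𝔽₂ → 𝔽₄`**: a Boolean function of `𝔽₂`-degree `≤ D` is, read in `𝔽₄`, an
`𝔽₄`-combination of monomials of degree `≤ D`. -/
theorem iotaF_mem_polySpan {D : ℕ} {f : (Fin m → Bool) → Bool} (hf : HasDeg f D) :
    (fun w => ιF (f w)) ∈ polySpan m D := by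
  classical
  -- the transfer map along `algebraMap (ZMod 2) F4`
  set φ := algebraMap (ZMod 2) F4 with hφ
  have key : ∀ F : CubeFn (ZMod 2) m, F ∈ lowDeg (ZMod 2) m D →
      (fun w => φ (F w)) ∈ polySpan m D := by
    intro F hF
    rw [lowDeg_eq_span] at hF
    induction hF using Submodule.span_induction with
    | mem G hG =>
      obtain ⟨⟨S, hS⟩, rfl⟩ := hG
      have e : (fun w => φ (mono (ZMod 2) S w)) = monoF S := by
        funext w
        unfold mono monoF ιF
        rw [map_prod]
        refine Finset.prod_congr rfl fun i _ => ?_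
        by_cases h : w i = true <;> simp [h]
      rw [e]
      exact Submodule.subset_span ⟨S, hS, rfl⟩
    | zero =>
      have e : (fun w : Fin m → Bool => φ ((0 : CubeFn (ZMod 2) m) w)) = 0 := by
        funext w; simp
      rw [e]; exact Submodule.zero_mem _
    | add G H _ _ hG hH =>
      have e : (fun w => φ ((G + H) w)) = (fun w => φ (G w)) + fun w => φ (H w) := by
        funext w; simp
      rw [e]; exact Submodule.add_mem _ hG hH
    | smul a G _ hG =>
      have e : (fun w => φ ((a • G) w)) = φ a • fun w => φ (G w) := by
        funext w; simp [smul_eq_mul]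
      rw [e]; exact Submodule.smul_mem _ _ hG
  have h := key _ hf
  have e : (fun w => φ ((fun x => if f x = true then (1 : ZMod 2) else 0) w)) = fun w => ιF (f w) := by
    funext w
    unfold ιF
    by_cases hw : f w = true <;> simp [hw]
  rw [e] at h
  exact h

/-- A degree-`≤ D` polynomial times a path character lies in the full module. -/
theorem polySpan_mul_chi_mem {D : ℕ} {h : (Fin m → Bool) → F4} (hh : h ∈ polySpan m D) (g : ℕ) :
    (fun w => h w * chi (aPat g) w) ∈ fullSpan m D := by
  unfold polySpan at hh
  induction hh using Submodule.span_induction with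
  | mem G hG =>
    obtain ⟨T, hT, rfl⟩ := hG
    exact Submodule.subset_span ⟨g, T, hT, rfl⟩
  | zero =>
    have e : (fun w : Fin m → Bool => (0 : (Fin m → Bool) → F4) w * chi (aPat g) w) = 0 := by
      funext w; simp
    rw [e]; exact Submodule.zero_mem _
  | add G H _ _ hG hH =>
    have e : (fun w => (G + H) w * chi (aPat g) w) =
        (fun w => G w * chi (aPat g) w) + fun w => H w * chi (aPat g) w := by
      funext w; simp [add_mul]
    rw [e]; exact Submodule.add_mem _ hG hH
  | smul a G _ hG =>
    have e : (fun w => (a • G) w * chi (aPat g) w) = a • fun w => G w * chi (aPat g) w := by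
      funext w; simp [smul_eq_mul, mul_assoc]
    rw [e]; exact Submodule.smul_mem _ _ hG

/-! ### The fibres of the first block are full strategies -/

variable {q : ℕ}

/-- Prefix weights beyond the end are the full weight. -/
private theorem wtPrefix_of_ge' (w : Fin m → Bool) {g : ℕ} (hg : m ≤ g) : wtPrefix w g = wt w := by
  unfold wtPrefix wt
  congr 1
  exact Finset.filter_congr fun i _ => by constructor <;> intro h <;> [exact h.2; exact ⟨by omega, h⟩]

/-- The walk exponent of `w ++ b` at a cut inside the first block. -/
private theorem walkExp_append_of_le (w : Fin m → Bool) (b : Fin q → Bool) {g : ℕ} (hg : g ≤ m) :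
    walkExp (Fin.append w b) g = walkExp w g + wt b := by
  unfold walkExp
  rw [wt_append, wtPrefix_append_of_le w b hg]
  ring

/-- The walk exponent of `w ++ b` at a cut beyond the first block. -/
private theorem walkExp_append_of_ge (w : Fin m → Bool) (b : Fin q → Bool) {g : ℕ} (hg : m ≤ g) :
    walkExp (Fin.append w b) g = walkExp w m + (wt b + wtPrefix b (g - m)) := by
  unfold walkExp
  rw [wt_append, wtPrefix_append_of_ge w b hg, wtPrefix_of_ge' w le_rfl]
  ring

/-- The strategy read on a fibre of the first block, as an `𝔽₄`-valued function. -/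
def fibreFun (c : ℕ) (y : Fin (m + q + 1) → (Fin (m + q) → Bool) → Bool) (b : Fin q → Bool)
    (w : Fin m → Bool) : F4 :=
  ∑ g : Fin (m + q + 1), ιF (y g (Fin.append w b)) * ω ^ (c + g.val + walkExp (Fin.append w b) g.val)

/-- **Each fibre of the first block is a FULL strategy of the same degree on that block.** -/
theorem fibre_mem_fullSpan {D : ℕ} (c : ℕ) (y : Fin (m + q + 1) → (Fin (m + q) → Bool) → Bool)
    (hy : ∀ g, HasDeg (y g) D) (b : Fin q → Bool) : fibreFun c y b ∈ fullSpan m D := by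
  classical
  have efun : fibreFun c y b = ∑ g : Fin (m + q + 1),
      (fun w : Fin m → Bool => ιF (y g (Fin.append w b)) * ω ^ (c + g.val + walkExp (Fin.append w b) g.val)) := by
    funext w
    simp only [fibreFun, Finset.sum_apply]
  rw [efun]
  refine Submodule.sum_mem _ fun g _ => ?_
  have hsel : (fun w : Fin m → Bool => ιF (y g (Fin.append w b))) ∈ polySpan m D :=
    iotaF_mem_polySpan (hasDeg_append_left b (hy g))
  by_cases hg : g.val ≤ m
  · -- a cut inside the block: the path character `a^{(g)}`, constant `ω^{c + g + |b|}`
    have e : (fun w : Fin m → Bool => ιF (y g (Fin.append w b)) *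
        ω ^ (c + g.val + walkExp (Fin.append w b) g.val)) =
        ω ^ (c + g.val + wt b) • fun w => ιF (y g (Fin.append w b)) * chi (aPat g.val) w := by
      funext w
      rw [Pi.smul_apply, smul_eq_mul, walkExp_append_of_le w b hg,
        show c + g.val + (walkExp w g.val + wt b) = (c + g.val + wt b) + walkExp w g.val by ring,
        pow_add, omega_pow_walkExp]
      ring
    rw [e]
    exact Submodule.smul_mem _ _ (polySpan_mul_chi_mem hsel g.val)
  · -- a cut beyond the block: the last path character `a^{(m)} = 2^m`
    have hg' : m ≤ g.val := by omega
    have e : (fun w : Fin m → Bool => ιF (y g (Fin.append w b)) *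
        ω ^ (c + g.val + walkExp (Fin.append w b) g.val)) =
        ω ^ (c + g.val + (wt b + wtPrefix b (g.val - m))) •
          fun w => ιF (y g (Fin.append w b)) * chi (aPat m) w := by
      funext w
      rw [Pi.smul_apply, smul_eq_mul, walkExp_append_of_ge w b hg',
        show c + g.val + (walkExp w m + (wt b + wtPrefix b (g.val - m))) =
          (c + g.val + (wt b + wtPrefix b (g.val - m))) + walkExp w m by ring,
        pow_add, omega_pow_walkExp]
      ring
    rw [e]
    exact Submodule.smul_mem _ _ (polySpan_mul_chi_mem hsel m)

/-- The fibre function evaluates the game: `tr (fibreFun w) = [WIN(w ++ b)]`. -/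
theorem tr_fibreFun (c : ℕ) (y : Fin (m + q + 1) → (Fin (m + q) → Bool) → Bool) (b : Fin q → Bool)
    (w : Fin m → Bool) : tr (fibreFun c y b w) = ιF (ringWinU c y (Fin.append w b)) := by
  unfold fibreFun
  rw [iotaF_ringWinU]

/-- **Every fibre of the first `2D+3` coordinates carries a failure.** -/
theorem exists_fail_on_fibre (D : ℕ) {q : ℕ} (c : ℕ)
    (y : Fin (2 * D + 3 + q + 1) → (Fin (2 * D + 3 + q) → Bool) → Bool) (hy : ∀ g, HasDeg (y g) D)
    (b : Fin q → Bool) : ∃ w : Fin (2 * D + 3) → Bool, ringWinU c y (Fin.append w b) = false := by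
  obtain ⟨w, hw⟩ := fullSpan_not_perfect D (fibre_mem_fullSpan c y hy b)
  refine ⟨w, ?_⟩
  rw [tr_fibreFun] at hw
  cases h : ringWinU c y (Fin.append w b)
  · rfl
  · rw [h] at hw
    exact absurd rfl hw

/-! ### The floor -/

/-- **THE FAIL FLOOR (block form).**  A walk strategy of degree `≤ D` on `(2D+3) + q` bits fails on
at least `2^q` inputs, for every charge. [folklore] -/
theorem ringWinU_fail_floor_append (D q c : ℕ)
    (y : Fin (2 * D + 3 + q + 1) → (Fin (2 * D + 3 + q) → Bool) → Bool) (hy : ∀ g, HasDeg (y g) D) :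
    2 ^ q ≤ (univ.filter fun u : Fin (2 * D + 3 + q) → Bool => ringWinU c y u = false).card := by
  classical
  choose wf hwf using fun b : Fin q → Bool => exists_fail_on_fibre D c y hy b
  have hinj : Set.InjOn (fun b : Fin q → Bool => Fin.append (wf b) b) (univ : Finset (Fin q → Bool)) := by
    intro b _ b' _ h
    funext j
    have := congrFun h (Fin.natAdd (2 * D + 3) j)
    simpa only [Fin.append_right] using this
  have hmaps : ∀ b ∈ (univ : Finset (Fin q → Bool)),
      Fin.append (wf b) b ∈ (univ.filter fun u : Fin (2 * D + 3 + q) → Bool => ringWinU c y u = false) :=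
    fun b _ => Finset.mem_filter.2 ⟨Finset.mem_univ _, hwf b⟩
  have h := Finset.card_le_card_of_injOn _ hmaps hinj
  rw [Finset.card_univ, Fintype.card_fun, Fintype.card_bool, Fintype.card_fin] at h
  exact h

/-- **THE FAIL FLOOR.**  Every walk strategy of `𝔽₂`-degree `≤ D` on `ℓ ≥ 2D+3` bits fails on at
least `2^{ℓ−(2D+3)}` inputs, for every charge (planner qa-qnc0-p1 TARGET §15.4(a)
`FullFailFloor`, all `D`, all `ℓ`). [folklore] -/
theorem ringWinU_fail_floor (D : ℕ) {ℓ : ℕ} (hℓ : 2 * D + 3 ≤ ℓ) (c : ℕ)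
    (y : Fin (ℓ + 1) → (Fin ℓ → Bool) → Bool) (hy : ∀ g, HasDeg (y g) D) :
    2 ^ (ℓ - (2 * D + 3)) ≤ (univ.filter fun u : Fin ℓ → Bool => ringWinU c y u = false).card := by
  obtain ⟨q, rfl⟩ : ∃ q, ℓ = 2 * D + 3 + q := ⟨ℓ - (2 * D + 3), by omega⟩
  rw [show 2 * D + 3 + q - (2 * D + 3) = q by omega]
  exact ringWinU_fail_floor_append D q c y hy

/-- **The win count under the floor**: `#WIN ≤ (1 − 2^{−(2D+3)})·2^ℓ` for every walk strategy of
degree `≤ D` on `ℓ ≥ 2D+3` bits. [folklore] -/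
theorem card_ringWinU_le_floor (D : ℕ) {ℓ : ℕ} (hℓ : 2 * D + 3 ≤ ℓ) (c : ℕ)
    (y : Fin (ℓ + 1) → (Fin ℓ → Bool) → Bool) (hy : ∀ g, HasDeg (y g) D) :
    ((univ.filter fun u : Fin ℓ → Bool => ringWinU c y u = true).card : ℝ) ≤
      (1 - (1 / 2 : ℝ) ^ (2 * D + 3)) * (2 : ℝ) ^ ℓ := by
  have hfl := ringWinU_fail_floor D hℓ c y hy
  have htot : (univ.filter fun u : Fin ℓ → Bool => ringWinU c y u = true).card +
      (univ.filter fun u : Fin ℓ → Bool => ringWinU c y u = false).card = 2 ^ ℓ := by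
    have h := Finset.card_filter_add_card_filter_not
      (s := (univ : Finset (Fin ℓ → Bool))) (fun u => ringWinU c y u = true)
    have hneg : (univ.filter fun u : Fin ℓ → Bool => ¬ ringWinU c y u = true) =
        univ.filter fun u : Fin ℓ → Bool => ringWinU c y u = false :=
      Finset.filter_congr fun u _ => by simp
    rw [hneg, Finset.card_univ, Fintype.card_fun, Fintype.card_bool, Fintype.card_fin] at h
    exact h
  have hflR : (2 : ℝ) ^ (ℓ - (2 * D + 3)) ≤
      ((univ.filter fun u : Fin ℓ → Bool => ringWinU c y u = false).card : ℝ) := by exact_mod_cast hfl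
  have htotR : ((univ.filter fun u : Fin ℓ → Bool => ringWinU c y u = true).card : ℝ) +
      ((univ.filter fun u : Fin ℓ → Bool => ringWinU c y u = false).card : ℝ) = (2 : ℝ) ^ ℓ := by
    exact_mod_cast htot
  have hpow : (1 / 2 : ℝ) ^ (2 * D + 3) * (2 : ℝ) ^ ℓ = (2 : ℝ) ^ (ℓ - (2 * D + 3)) := by
    have h2 : (2 : ℝ) ^ ℓ = (2 : ℝ) ^ (ℓ - (2 * D + 3)) * (2 : ℝ) ^ (2 * D + 3) := by
      rw [← pow_add, Nat.sub_add_cancel hℓ]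
    rw [h2, div_pow, one_pow]
    field_simp
  rw [sub_mul, one_mul, hpow]
  linarith

/-! ### The mixed game -/

/-- **The fail floor of the mixed game**: `MixedHardAt ℓ D (1 − 2^{−(2D+5)})` for `ℓ ≥ 2D+5`
(an even triple of degree `≤ D` is a walk strategy of degree `D+1`, `evenTriple_isWalkRow`). [folklore] -/
theorem mixedHardAt_floor (D : ℕ) {ℓ : ℕ} (hℓ : 2 * D + 5 ≤ ℓ) :
    MixedHardAt ℓ D (1 - (1 / 2 : ℝ) ^ (2 * D + 5)) := by
  intro c P y hPdeg hPeven hy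
  have hℓ1 : 1 ≤ ℓ := by omega
  obtain ⟨yP, hyP, hwin⟩ := evenTriple_isWalkRow ℓ hℓ1 c D P ⟨hPdeg, hPeven⟩
  have e : (univ.filter fun w : Fin ℓ → Bool => mixedWinU c P y w = true) =
      univ.filter fun w : Fin ℓ → Bool => ringWinU c (fun g w => xor (yP g w) (y g w)) w = true := by
    refine Finset.filter_congr fun w _ => ?_
    unfold mixedWinU
    have hw : P (wt w % 3) w = ringWinU c yP w := hwin w
    rw [hw, ringWinU_xor]
  rw [e]
  have hdeg : ∀ g, HasDeg ((fun g w => xor (yP g w) (y g w)) g) (D + 1) := fun g =>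
    hasDeg_xor (hyP g) (hasDeg_of_le (hy g) (Nat.le_succ _))
  have h := card_ringWinU_le_floor (D + 1) (ℓ := ℓ) (by omega) c _ hdeg
  rw [show 2 * (D + 1) + 3 = 2 * D + 5 by ring] at h
  exact h

end Summit.QuantumAdvantage.AdviceFreeQNC0

end
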